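import Summits.Ventures.HodgeRepro2.T5SU11JacobiPhaseLipschitz
import Summits.Ventures.HodgeRepro2.T5SU11JacobiMeanPhaseRate

/-!
# The second-order bound `Φ_λ(s) ≤ 1 − c s + c² s²/2` in the phase, and the next term of the mean phase:
`k (k ⟨log|a|⟩_{k,λ} − 1) → 2 − c`

`T5SU11JacobiPhaseLipschitz` gives `1 − c s ≤ Φ_λ(s) ≤ 1`, `c = λ(2 − λ)/2`, for `0 ≤ λ ≤ 2`. Feeding the lower
bound back into the integrated radial equation `sinh 2t · u'(t) = λ(λ − 2) ∫_0^t sinh 2τ · u(τ) dτ`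
(`T5SU11SphericalLipschitz`) gives the sharper derivative bound

  **`u'(t) ≤ −c tanh t · (1 − c log cosh t)`**,  `t > 0`   (`deriv_sph_hyp_le`),

so `u − 1 + c log cosh t − (c²/2)(log cosh t)²` is antitone on `[0, ∞)` and, in the phase `s = log cosh t`,

  **`1 − c s ≤ Φ_λ(s) ≤ 1 − c s + c² s²/2`**   (`sphPhase_le_one_sub_add`):

the Lipschitz constant `c` is SHARP at `s = 0` (`u''(0) = λ(λ − 2)/2 = −c`) and the remainder is of second order
with the explicit constant `c²/2`. Consequences, with `r = k − 2`:

* the moment integrals from above to second order, `∫_0^∞ sⁿ e^{−rs} Φ_λ ≤ n!/r^{n+1} − c (n+1)!/r^{n+2} + (c²/2)(n+2)!/r^{n+3}`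
  (`moment_phase_le'`), in particular the mass `N(0) ≤ 1/r − c/r² + c²/r³`;
* the mean phase pinned to second order (`k ≥ 3`), `(r − 2c)/(r² − cr + c²) ≤ ⟨log|a|⟩_{k,λ} ≤ (r² − 2cr + 3c²)/(r²(r − c))`
  (`mean_phase_ge'`, `mean_phase_le'`);
* **the next term of the mean phase**: `k (k ⟨log|a|⟩_{k,λ} − 1) → 2 − c` as `k → ∞` (`tendsto_mul_mul_mean_phase_sub_one`),
  i.e. `⟨log|a|⟩_{k,λ} = 1/k + (2 − c)/k² + o(1/k²)` — at `λ = 0` the exact `1/(k − 2) = 1/k + 2/k² + …`, at the owner's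
  `λ = 1` (`c = 1/2`) the coefficient `3/2`.

Nothing is claimed about (N).

Blind lane: Mathlib + the HodgeRepro2 prefix only; no sorry; axioms ⊆ {propext, Classical.choice,
Quot.sound}.
-/

namespace Summit.Ventures.HodgeRepro2.T5SU11JacobiPhaseSecondOrder

open MeasureTheory MeasureTheory.Measure Metric Set Filter Topology
open T5SU11Unimodular T5SU11Fibration T5SU11Cartan T5SU11OneParameter T5SU11CartanProjection T5HaarCircle
  T5BergmanCoefficient T5SU11FibrationHaar T5SU11SphericalFunction T5SU11SphericalSymmetry
  T5SU11SphericalBounds T5SU11SphericalContinuous T5SU11SphericalDeriv T5SU11SphericalLipschitz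
  T5SU11JacobiLaplacePhase T5SU11PhaseLawLintegral T5SU11JacobiPhaseLipschitz T5SU11JacobiPhaseLawRate
  T5SU11JacobiMeanPhaseRate
open scoped Real

/-- `sⁿ e^{−rs} (1 − c s + (c²/2) s²)` is integrable on `(0, ∞)` for `r > 0`. -/
theorem integrableOn_pow_mul_exp_neg_mul_quadratic_Ioi (n : ℕ) {r : ℝ} (hr : 0 < r) (c : ℝ) :
    IntegrableOn (fun s : ℝ => s ^ n * Real.exp (-(r * s)) * (1 - c * s + c ^ 2 / 2 * s ^ 2)) (Ioi 0) := by
  have h1 := integrableOn_pow_mul_exp_neg_mul_one_sub_Ioi n hr c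
  have h2 := (integrableOn_pow_mul_exp_neg_mul_Ioi' (n + 2) hr).const_mul (c ^ 2 / 2)
  refine (h1.add h2).congr_fun (fun s _ => ?_) measurableSet_Ioi
  simp only [Pi.add_apply, pow_succ]
  ring

/-! ### The next term of the mean phase -/

/-- The lower envelope in the variable `ε = 1/r`, `r = k − 2 > 0`:
`(r + 2)((r + 2)(r − 2c)/(r² − c r + c²) − 1) = (1 + 2ε)(2 − c − (4c + c²)ε)/(1 − cε + c²ε²)`. -/
theorem lower_envelope_eq {r c : ℝ} (hr : 0 < r) :
    (r + 2) * ((r + 2) * ((r - 2 * c) / (r ^ 2 - c * r + c ^ 2)) - 1)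
      = (1 + 2 * (1 / r)) * (2 - c - (4 * c + c ^ 2) * (1 / r)) / (1 - c * (1 / r) + c ^ 2 * (1 / r) ^ 2) := by
  have hr0 : r ≠ 0 := hr.ne'
  set Q : ℝ := r ^ 2 - c * r + c ^ 2 with hQ
  have hq : Q ≠ 0 := by
    have : 0 < Q := by
      rw [hQ]
      nlinarith [sq_nonneg (r / 2 - c), sq_pos_of_pos hr]
    exact this.ne'
  have hq' : 1 - c * (1 / r) + c ^ 2 * (1 / r) ^ 2 ≠ 0 := by
    have : 0 < 1 - c * (1 / r) + c ^ 2 * (1 / r) ^ 2 := by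
      nlinarith [sq_nonneg (c * (1 / r) - 1 / 2)]
    exact this.ne'
  have e : (r + 2) * ((r + 2) * ((r - 2 * c) / Q) - 1) = (r + 2) * ((r + 2) * (r - 2 * c) - Q) / Q := by
    field_simp
  rw [e, div_eq_div_iff hq hq']
  field_simp
  rw [hQ]
  ring

/-- The upper envelope in the variable `ε = 1/r`, `r = k − 2 > c`:
`(r + 2)((r + 2)(r² − 2cr + 3c²)/(r²(r − c)) − 1) = (1 + 2ε)(2 − c − 4cε + 3c²ε + 6c²ε²)/(1 − cε)`. -/
theorem upper_envelope_eq {r c : ℝ} (hr : 0 < r) (hrc : c < r) :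
    (r + 2) * ((r + 2) * ((r ^ 2 - 2 * c * r + 3 * c ^ 2) / (r ^ 2 * (r - c))) - 1)
      = (1 + 2 * (1 / r)) * (2 - c - 4 * c * (1 / r) + 3 * c ^ 2 * (1 / r) + 6 * c ^ 2 * (1 / r) ^ 2)
        / (1 - c * (1 / r)) := by
  have hr0 : r ≠ 0 := hr.ne'
  set D : ℝ := r - c with hD
  have hD0 : D ≠ 0 := by
    have : 0 < D := by rw [hD]; linarith
    exact this.ne'
  have hq : r ^ 2 * D ≠ 0 := mul_ne_zero (pow_ne_zero 2 hr0) hD0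
  have hq' : 1 - c * (1 / r) ≠ 0 := by
    have : c * (1 / r) < 1 := by
      rw [mul_one_div, div_lt_one hr]
      exact hrc
    linarith
  have e : (r + 2) * ((r + 2) * ((r ^ 2 - 2 * c * r + 3 * c ^ 2) / (r ^ 2 * D)) - 1)
      = (r + 2) * ((r + 2) * (r ^ 2 - 2 * c * r + 3 * c ^ 2) - r ^ 2 * D) / (r ^ 2 * D) := by
    field_simp
  rw [e, div_eq_div_iff hq hq']
  field_simp
  rw [hD]
  ring

section measure

variable [MeasurableSpace Circle] [BorelSpace Circle]

/-! ### The sharper derivative bound -/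

/-- `u(0) = 1`. -/
theorem sph_hyp_zero_eq_one (lam : ℝ) : sph lam (hyp 0) = 1 := by
  rw [T5SU11OneParameter.hyp_zero, sph_one]

/-- **`1 − c log cosh t ≤ u(t)`** for `t ≥ 0`, `0 ≤ λ ≤ 2` (the Lipschitz bound in the phase at `t' = 0`). -/
theorem one_sub_mul_log_cosh_le_sph_hyp {lam : ℝ} (h0 : 0 ≤ lam) (h2 : lam ≤ 2) {t : ℝ} (ht : 0 ≤ t) :
    1 - lam * (2 - lam) / 2 * Real.log (Real.cosh t) ≤ sph lam (hyp t) := by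
  have h := abs_sph_hyp_sub_le_log_cosh h0 h2 ht (le_refl (0 : ℝ))
  rw [sph_hyp_zero_eq_one, Real.cosh_zero, Real.log_one, sub_zero,
    abs_of_nonneg (Real.log_nonneg (Real.one_le_cosh t)), abs_le] at h
  linarith [h.1]

/-- **The integral of the radial equation from below**: for `0 ≤ λ ≤ 2`, `t ≥ 0`,
`((cosh 2t − 1)/2)(1 − c log cosh t) ≤ ∫_0^t sinh 2τ · u(τ) dτ`. -/
theorem integral_sinh_mul_sph_hyp_ge {lam : ℝ} (h0 : 0 ≤ lam) (h2 : lam ≤ 2) {t : ℝ} (ht : 0 ≤ t) :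
    (Real.cosh (2 * t) - 1) / 2 * (1 - lam * (2 - lam) / 2 * Real.log (Real.cosh t))
      ≤ ∫ s in (0 : ℝ)..t, Real.sinh (2 * s) * sph lam (hyp s) := by
  set c : ℝ := lam * (2 - lam) / 2 with hc
  have hc0 : 0 ≤ c := by rw [hc]; nlinarith
  have hI : ∫ s in (0 : ℝ)..t, Real.sinh (2 * s) * (1 - c * Real.log (Real.cosh t))
      = (Real.cosh (2 * t) - 1) / 2 * (1 - c * Real.log (Real.cosh t)) := by
    rw [intervalIntegral.integral_mul_const, integral_sinh_two_mul]
  rw [← hI]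
  refine intervalIntegral.integral_mono_on ht
    ((by fun_prop : Continuous fun s : ℝ => Real.sinh (2 * s) * (1 - c * Real.log (Real.cosh t))).intervalIntegrable _ _)
    ((continuous_sinh_mul_sph_hyp lam).intervalIntegrable _ _) fun s hs => ?_
  have hsh : 0 ≤ Real.sinh (2 * s) := Real.sinh_nonneg_iff.mpr (by linarith [hs.1])
  refine mul_le_mul_of_nonneg_left ?_ hsh
  refine le_trans ?_ (one_sub_mul_log_cosh_le_sph_hyp h0 h2 hs.1)
  have hst : s ≤ t := hs.2
  have hlc : Real.log (Real.cosh s) ≤ Real.log (Real.cosh t) := by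
    apply Real.log_le_log (Real.cosh_pos s)
    rw [← Real.cosh_abs s, ← Real.cosh_abs t, abs_of_nonneg hs.1, abs_of_nonneg ht]
    exact Real.cosh_le_cosh.mpr (by rwa [abs_of_nonneg hs.1, abs_of_nonneg ht])
  rw [← hc]
  nlinarith [mul_le_mul_of_nonneg_left hlc hc0]

/-- **THE SHARPER DERIVATIVE BOUND**: for `0 ≤ λ ≤ 2` and `t > 0`,
`u'(t) ≤ −c tanh t · (1 − c log cosh t)`, `c = λ(2 − λ)/2`. -/
theorem deriv_sph_hyp_le {lam : ℝ} (h0 : 0 ≤ lam) (h2 : lam ≤ 2) {t : ℝ} (ht : 0 < t) :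
    deriv (fun t => sph lam (hyp t)) t
      ≤ -(lam * (2 - lam) / 2) * Real.tanh t * (1 - lam * (2 - lam) / 2 * Real.log (Real.cosh t)) := by
  set c : ℝ := lam * (2 - lam) / 2 with hc
  have hs : 0 < Real.sinh (2 * t) := Real.sinh_pos_iff.mpr (by linarith)
  have h := sinh_mul_deriv_eq_integral lam t
  have hI := integral_sinh_mul_sph_hyp_ge h0 h2 ht.le
  rw [← hc] at hI
  have hl : lam * (lam - 2) = -(2 * c) := by rw [hc]; ring
  rw [hl] at h
  -- `sinh 2t · u' ≤ −2c · ((cosh 2t − 1)/2)(1 − c log cosh t) = −c (cosh 2t − 1)(1 − c log cosh t)`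
  have hc0 : 0 ≤ c := by rw [hc]; nlinarith
  have h1 : Real.sinh (2 * t) * deriv (fun t => sph lam (hyp t)) t
      ≤ -c * (Real.cosh (2 * t) - 1) * (1 - c * Real.log (Real.cosh t)) := by
    rw [h]
    nlinarith [mul_le_mul_of_nonneg_left hI (by linarith : (0 : ℝ) ≤ 2 * c)]
  rw [cosh_two_mul_sub_one] at h1
  have h2' : Real.sinh (2 * t) * deriv (fun t => sph lam (hyp t)) t
      ≤ Real.sinh (2 * t) * (-c * Real.tanh t * (1 - c * Real.log (Real.cosh t))) := by
    calc Real.sinh (2 * t) * deriv (fun t => sph lam (hyp t)) t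
        ≤ -c * (Real.sinh (2 * t) * Real.tanh t) * (1 - c * Real.log (Real.cosh t)) := h1
      _ = Real.sinh (2 * t) * (-c * Real.tanh t * (1 - c * Real.log (Real.cosh t))) := by ring
  exact le_of_mul_le_mul_left h2' hs

/-! ### The second-order bound in the phase -/

/-- **`u − 1 + c log cosh t − (c²/2)(log cosh t)²` is antitone on `[0, ∞)`** for `0 ≤ λ ≤ 2`. -/
theorem antitoneOn_sph_hyp_second_order {lam : ℝ} (h0 : 0 ≤ lam) (h2 : lam ≤ 2) :
    AntitoneOn (fun t : ℝ => sph lam (hyp t) - 1 + lam * (2 - lam) / 2 * Real.log (Real.cosh t)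
      - (lam * (2 - lam) / 2) ^ 2 / 2 * Real.log (Real.cosh t) ^ 2) (Ici 0) := by
  set c : ℝ := lam * (2 - lam) / 2 with hc
  have hdiff : Differentiable ℝ fun t : ℝ => sph lam (hyp t) - 1 + c * Real.log (Real.cosh t)
      - c ^ 2 / 2 * Real.log (Real.cosh t) ^ 2 :=
    (((differentiable_sph_hyp lam).sub (differentiable_const 1)).add
      (differentiable_log_cosh.const_mul c)).sub ((differentiable_log_cosh.pow 2).const_mul (c ^ 2 / 2))
  refine antitoneOn_of_deriv_nonpos (convex_Ici 0) hdiff.continuous.continuousOn hdiff.differentiableOn ?_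
  intro x hx
  rw [interior_Ici] at hx
  have hd : HasDerivAt (fun t : ℝ => sph lam (hyp t) - 1 + c * Real.log (Real.cosh t)
      - c ^ 2 / 2 * Real.log (Real.cosh t) ^ 2)
      (deriv (fun t => sph lam (hyp t)) x + c * Real.tanh x
        - c ^ 2 / 2 * (2 * Real.log (Real.cosh x) * Real.tanh x)) x := by
    have h1 := (differentiable_sph_hyp lam x).hasDerivAt
    have h2 := (hasDerivAt_log_cosh x).const_mul c
    have h3 := ((hasDerivAt_log_cosh x).pow 2).const_mul (c ^ 2 / 2)
    have := ((h1.sub (hasDerivAt_const x (1 : ℝ))).add h2).sub h3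
    refine this.congr_deriv ?_
    push_cast
    ring
  rw [hd.deriv]
  have hu := deriv_sph_hyp_le h0 h2 hx
  rw [← hc] at hu
  nlinarith [hu]

/-- **THE SECOND-ORDER BOUND IN THE PHASE**: for `0 ≤ λ ≤ 2`, `s ≥ 0`, `Φ_λ(s) ≤ 1 − c s + c² s²/2`,
`c = λ(2 − λ)/2`. -/
theorem sphPhase_le_one_sub_add {lam : ℝ} (h0 : 0 ≤ lam) (h2 : lam ≤ 2) {s : ℝ} (hs : 0 ≤ s) :
    sphPhase lam s ≤ 1 - lam * (2 - lam) / 2 * s + (lam * (2 - lam) / 2) ^ 2 / 2 * s ^ 2 := by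
  have h := antitoneOn_sph_hyp_second_order h0 h2 (mem_Ici.mpr (le_refl (0 : ℝ)))
    (mem_Ici.mpr (cartanOfPhase_nonneg' s)) (cartanOfPhase_nonneg' s)
  simp only [sph_hyp_zero_eq_one, Real.cosh_zero, Real.log_one, log_cosh_cartanOfPhase hs] at h
  unfold sphPhase
  nlinarith [h]

/-! ### The moments from above to second order -/

/-- **The moment integrals from above, second order**: for `k > 2`, `0 ≤ λ ≤ 2`, with `r = k − 2`,
`∫_0^∞ sⁿ e^{−rs} Φ_λ(s) ds ≤ n!/r^{n+1} − c (n+1)!/r^{n+2} + (c²/2)(n+2)!/r^{n+3}`. -/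
theorem moment_phase_le' (n : ℕ) {k lam : ℝ} (hk : 2 < k) (h0 : 0 ≤ lam) (h2 : lam ≤ 2) :
    ∫ s in Ioi (0 : ℝ), s ^ n * Real.exp (-((k - 2) * s)) * sphPhase lam s
      ≤ (n.factorial : ℝ) / (k - 2) ^ (n + 1) - lam * (2 - lam) / 2 * ((n + 1).factorial : ℝ) / (k - 2) ^ (n + 2)
        + (lam * (2 - lam) / 2) ^ 2 / 2 * ((n + 2).factorial : ℝ) / (k - 2) ^ (n + 3) := by
  have hr : 0 < k - 2 := by linarith
  set c : ℝ := lam * (2 - lam) / 2 with hc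
  have hval : ∫ s in Ioi (0 : ℝ), s ^ n * Real.exp (-((k - 2) * s)) * (1 - c * s + c ^ 2 / 2 * s ^ 2)
      = (n.factorial : ℝ) / (k - 2) ^ (n + 1) - c * ((n + 1).factorial : ℝ) / (k - 2) ^ (n + 2)
        + c ^ 2 / 2 * ((n + 2).factorial : ℝ) / (k - 2) ^ (n + 3) := by
    have e : ∀ s : ℝ, s ^ n * Real.exp (-((k - 2) * s)) * (1 - c * s + c ^ 2 / 2 * s ^ 2)
        = s ^ n * Real.exp (-((k - 2) * s)) * (1 - c * s)
          + c ^ 2 / 2 * (s ^ (n + 2) * Real.exp (-((k - 2) * s))) := fun s => by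
      rw [pow_succ, pow_succ]
      ring
    simp_rw [e]
    rw [integral_add (integrableOn_pow_mul_exp_neg_mul_one_sub_Ioi n hr c)
      ((integrableOn_pow_mul_exp_neg_mul_Ioi' (n + 2) hr).const_mul _), integral_const_mul,
      integral_pow_mul_exp_neg_mul_Ioi (n + 2) hr]
    have e2 : ∀ s : ℝ, s ^ n * Real.exp (-((k - 2) * s)) * (1 - c * s)
        = s ^ n * Real.exp (-((k - 2) * s)) - c * (s ^ (n + 1) * Real.exp (-((k - 2) * s))) := fun s => by
      rw [pow_succ]
      ring
    simp_rw [e2]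
    rw [integral_sub (integrableOn_pow_mul_exp_neg_mul_Ioi' n hr)
      ((integrableOn_pow_mul_exp_neg_mul_Ioi' (n + 1) hr).const_mul c), integral_const_mul,
      integral_pow_mul_exp_neg_mul_Ioi n hr, integral_pow_mul_exp_neg_mul_Ioi (n + 1) hr]
    ring
  rw [← hval]
  refine setIntegral_mono_on (integrableOn_pow_mul_exp_mul_sphPhase n hk h0 h2)
    (integrableOn_pow_mul_exp_neg_mul_quadratic_Ioi n hr c) measurableSet_Ioi fun s hs => ?_
  have hs0 : 0 ≤ s := le_of_lt hs
  exact mul_le_mul_of_nonneg_left (sphPhase_le_one_sub_add h0 h2 hs0)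
    (mul_nonneg (pow_nonneg hs0 n) (Real.exp_pos _).le)

/-! ### The mean phase to second order -/

/-- **The mean phase from below, second order**: for `k ≥ 3`, `0 ≤ λ ≤ 2`, `r = k − 2`,
`(r − 2c)/(r² − c r + c²) ≤ ⟨log|a|⟩_{k,λ}`. -/
theorem mean_phase_ge' {k lam : ℝ} (hk : 3 ≤ k) (h0 : 0 ≤ lam) (h2 : lam ≤ 2) :
    ((k - 2) - 2 * (lam * (2 - lam) / 2)) / ((k - 2) ^ 2 - lam * (2 - lam) / 2 * (k - 2) + (lam * (2 - lam) / 2) ^ 2)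
      ≤ (∫ g, Real.log ‖mat g 0 0‖ * ((1 - ‖orbit g‖ ^ 2) ^ (k / 2) * sph lam g) ∂(nu haarCircle))
        / (∫ g, (1 - ‖orbit g‖ ^ 2) ^ (k / 2) * sph lam g ∂(nu haarCircle)) := by
  have hk2 : 2 < k := by linarith
  have hr : 0 < k - 2 := by linarith
  have hr1 : 1 ≤ k - 2 := by linarith
  set c : ℝ := lam * (2 - lam) / 2 with hc
  have hc0 : 0 ≤ c := by rw [hc]; nlinarith
  have hc1 : c ≤ 1 / 2 := by rw [hc]; nlinarith [sq_nonneg (lam - 1)]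
  have hm := normalized_moment_eq_phase 1 hk2 h0 h2
  simp only [pow_one] at hm
  rw [hm]
  have hA := le_moment_phase 1 hk2 h0 h2
  simp only [pow_one, Nat.factorial_one, Nat.cast_one, Nat.reduceAdd, Nat.factorial_two, Nat.cast_ofNat] at hA
  rw [← hc] at hA
  have hN := moment_phase_le' 0 hk2 h0 h2
  simp only [pow_zero, one_mul, Nat.factorial_zero, Nat.cast_one, zero_add, pow_one, Nat.factorial_one,
    Nat.factorial_two, Nat.cast_ofNat] at hN
  rw [← hc] at hN
  have hNpos := tail_zero_pos hk2 h0 h2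
  have hq : 0 < (k - 2) ^ 2 - c * (k - 2) + c ^ 2 := by nlinarith [sq_nonneg (k - 2 - c / 2)]
  have hnum : 0 ≤ (k - 2) - 2 * c := by linarith
  -- `N(0) ≤ (r² − c r + c²)/r³` and `∫ s e^{−rs} Φ ≥ (r − 2c)/r³`
  have hN' : ∫ s in Ioi (0 : ℝ), Real.exp (-((k - 2) * s)) * sphPhase lam s
      ≤ ((k - 2) ^ 2 - c * (k - 2) + c ^ 2) / (k - 2) ^ 3 := by
    refine hN.trans (le_of_eq ?_)
    field_simp
  have hA' : ((k - 2) - 2 * c) / (k - 2) ^ 3 ≤ ∫ s in Ioi (0 : ℝ), s * Real.exp (-((k - 2) * s)) * sphPhase lam s := by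
    refine le_trans (le_of_eq ?_) hA
    field_simp
  rw [div_le_div_iff₀ hq hNpos]
  calc ((k - 2) - 2 * c) * ∫ s in Ioi (0 : ℝ), Real.exp (-((k - 2) * s)) * sphPhase lam s
      ≤ ((k - 2) - 2 * c) * (((k - 2) ^ 2 - c * (k - 2) + c ^ 2) / (k - 2) ^ 3) :=
        mul_le_mul_of_nonneg_left hN' hnum
    _ = (((k - 2) - 2 * c) / (k - 2) ^ 3) * ((k - 2) ^ 2 - c * (k - 2) + c ^ 2) := by ring
    _ ≤ (∫ s in Ioi (0 : ℝ), s * Real.exp (-((k - 2) * s)) * sphPhase lam s)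
          * ((k - 2) ^ 2 - c * (k - 2) + c ^ 2) := mul_le_mul_of_nonneg_right hA' hq.le

/-- **The mean phase from above, second order**: for `k ≥ 3`, `0 ≤ λ ≤ 2`, `r = k − 2`,
`⟨log|a|⟩_{k,λ} ≤ (r² − 2c r + 3c²)/(r² (r − c))`. -/
theorem mean_phase_le' {k lam : ℝ} (hk : 3 ≤ k) (h0 : 0 ≤ lam) (h2 : lam ≤ 2) :
    (∫ g, Real.log ‖mat g 0 0‖ * ((1 - ‖orbit g‖ ^ 2) ^ (k / 2) * sph lam g) ∂(nu haarCircle))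
        / (∫ g, (1 - ‖orbit g‖ ^ 2) ^ (k / 2) * sph lam g ∂(nu haarCircle))
      ≤ ((k - 2) ^ 2 - 2 * (lam * (2 - lam) / 2) * (k - 2) + 3 * (lam * (2 - lam) / 2) ^ 2)
        / ((k - 2) ^ 2 * ((k - 2) - lam * (2 - lam) / 2)) := by
  have hk2 : 2 < k := by linarith
  have hr : 0 < k - 2 := by linarith
  set c : ℝ := lam * (2 - lam) / 2 with hc
  have hc0 : 0 ≤ c := by rw [hc]; nlinarith
  have hc1 : c ≤ 1 / 2 := by rw [hc]; nlinarith [sq_nonneg (lam - 1)]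
  have hm := normalized_moment_eq_phase 1 hk2 h0 h2
  simp only [pow_one] at hm
  rw [hm]
  have hA := moment_phase_le' 1 hk2 h0 h2
  have hf3 : ((1 + 2).factorial : ℝ) = 6 := by norm_num [Nat.factorial]
  simp only [pow_one, Nat.factorial_one, Nat.cast_one, Nat.reduceAdd, Nat.factorial_two, Nat.cast_ofNat,
    hf3] at hA
  rw [← hc] at hA
  have hN : ((k - 2) - c) / (k - 2) ^ 2 ≤ ∫ s in Ioi (0 : ℝ), Real.exp (-((k - 2) * s)) * sphPhase lam s := by
    have h := le_tail hk2 h0 h2 (le_refl (0 : ℝ))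
    simp only [mul_zero, neg_zero, Real.exp_zero, one_mul, zero_add, mul_one_div] at h
    rw [← hc] at h
    refine le_trans (le_of_eq ?_) h
    field_simp
  have hNpos := tail_zero_pos hk2 h0 h2
  have hrc : 0 < (k - 2) - c := by linarith
  have hden : 0 < (k - 2) ^ 2 * ((k - 2) - c) := by positivity
  have hA' : ∫ s in Ioi (0 : ℝ), s * Real.exp (-((k - 2) * s)) * sphPhase lam s
      ≤ ((k - 2) ^ 2 - 2 * c * (k - 2) + 3 * c ^ 2) / (k - 2) ^ 4 := by
    refine hA.trans (le_of_eq ?_)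
    field_simp
    ring
  have hA0 : 0 ≤ (k - 2) ^ 2 - 2 * c * (k - 2) + 3 * c ^ 2 := by nlinarith [sq_nonneg (k - 2 - c)]
  rw [div_le_div_iff₀ hNpos hden]
  calc (∫ s in Ioi (0 : ℝ), s * Real.exp (-((k - 2) * s)) * sphPhase lam s) * ((k - 2) ^ 2 * ((k - 2) - c))
      ≤ (((k - 2) ^ 2 - 2 * c * (k - 2) + 3 * c ^ 2) / (k - 2) ^ 4) * ((k - 2) ^ 2 * ((k - 2) - c)) :=
        mul_le_mul_of_nonneg_right hA' hden.le
    _ = ((k - 2) ^ 2 - 2 * c * (k - 2) + 3 * c ^ 2) * (((k - 2) - c) / (k - 2) ^ 2) := by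
        field_simp
    _ ≤ ((k - 2) ^ 2 - 2 * c * (k - 2) + 3 * c ^ 2)
          * ∫ s in Ioi (0 : ℝ), Real.exp (-((k - 2) * s)) * sphPhase lam s :=
        mul_le_mul_of_nonneg_left hN hA0

/-- **THE NEXT TERM OF THE MEAN PHASE**: for `0 ≤ λ ≤ 2`, `k (k ⟨log|a|⟩_{k,λ} − 1) → 2 − c` as `k → ∞`,
`c = λ(2 − λ)/2`: `⟨log|a|⟩_{k,λ} = 1/k + (2 − c)/k² + o(1/k²)`. -/
theorem tendsto_mul_mul_mean_phase_sub_one {lam : ℝ} (h0 : 0 ≤ lam) (h2 : lam ≤ 2) :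
    Tendsto (fun k : ℝ => k * (k *
      ((∫ g, Real.log ‖mat g 0 0‖ * ((1 - ‖orbit g‖ ^ 2) ^ (k / 2) * sph lam g) ∂(nu haarCircle))
        / (∫ g, (1 - ‖orbit g‖ ^ 2) ^ (k / 2) * sph lam g ∂(nu haarCircle))) - 1))
      atTop (𝓝 (2 - lam * (2 - lam) / 2)) := by
  set c : ℝ := lam * (2 - lam) / 2 with hc
  have hc0 : 0 ≤ c := by rw [hc]; nlinarith
  have hc1 : c ≤ 1 / 2 := by rw [hc]; nlinarith [sq_nonneg (lam - 1)]
  -- `ε = 1/(k − 2) → 0`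
  have hε : Tendsto (fun k : ℝ => 1 / (k - 2)) atTop (𝓝 0) :=
    (tendsto_atTop_add_const_right atTop (-2) tendsto_id).const_div_atTop 1 |>.congr'
      (Filter.Eventually.of_forall fun k => by simp only [id, sub_eq_add_neg])
  -- the two envelopes as continuous functions of `ε` at `ε = 0`
  have hL : Tendsto (fun ε : ℝ => (1 + 2 * ε) * (2 - c - (4 * c + c ^ 2) * ε) / (1 - c * ε + c ^ 2 * ε ^ 2))
      (𝓝 0) (𝓝 (2 - c)) := by
    have hcont : ContinuousAt (fun ε : ℝ => (1 + 2 * ε) * (2 - c - (4 * c + c ^ 2) * ε)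
        / (1 - c * ε + c ^ 2 * ε ^ 2)) 0 := by
      apply ContinuousAt.div
      · fun_prop
      · fun_prop
      · norm_num
    have := hcont.tendsto
    norm_num at this
    exact this
  have hU : Tendsto (fun ε : ℝ => (1 + 2 * ε) * (2 - c - 4 * c * ε + 3 * c ^ 2 * ε + 6 * c ^ 2 * ε ^ 2)
      / (1 - c * ε)) (𝓝 0) (𝓝 (2 - c)) := by
    have hcont : ContinuousAt (fun ε : ℝ => (1 + 2 * ε) * (2 - c - 4 * c * ε + 3 * c ^ 2 * ε + 6 * c ^ 2 * ε ^ 2)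
        / (1 - c * ε)) 0 := by
      apply ContinuousAt.div
      · fun_prop
      · fun_prop
      · norm_num
    have := hcont.tendsto
    norm_num at this
    exact this
  refine tendsto_of_tendsto_of_tendsto_of_le_of_le' (hL.comp hε) (hU.comp hε) ?_ ?_
  · filter_upwards [eventually_ge_atTop (3 : ℝ)] with k hk
    have hr : 0 < k - 2 := by linarith
    have hk0 : 0 < k := by linarith
    simp only [Function.comp_apply]
    rw [← lower_envelope_eq (c := c) hr, show k - 2 + 2 = k by ring]
    have := mean_phase_ge' hk h0 h2
    rw [← hc] at this
    have hkk : 0 ≤ k * k := by positivity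
    nlinarith [mul_le_mul_of_nonneg_left this hkk]
  · filter_upwards [eventually_ge_atTop (3 : ℝ)] with k hk
    have hr : 0 < k - 2 := by linarith
    have hk0 : 0 < k := by linarith
    simp only [Function.comp_apply]
    rw [← upper_envelope_eq (c := c) hr (by linarith), show k - 2 + 2 = k by ring]
    have := mean_phase_le' hk h0 h2
    rw [← hc] at this
    have hkk : 0 ≤ k * k := by positivity
    nlinarith [mul_le_mul_of_nonneg_left this hkk]

end measure

end Summit.Ventures.HodgeRepro2.T5SU11JacobiPhaseSecondOrder
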